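import Literature.AlgebraicGeometry.Resolution.BlowupAlgebraQuasiRegularChart
import Literature.AlgebraicGeometry.Resolution.BlowupAlgebraPresentation
import Literature.AlgebraicGeometry.Resolution.BlowupChartSNCLocal
import Literature.AlgebraicGeometry.Resolution.Dehomogenization
import HarnessLib

/-!
# [OURS · L1 W4.5(b)] T-CARRIER-Δ, ring core: a CONE `V(Φ(x))` through the centre on the chart
# `R[I/xᵢ]` — strict transform `= (Φ(x/xᵢ))`, its trace on the exceptional divisor `= V(Φ̄(Tᵢ := 1))`

Support file of the crux chain w45b (cell `res-hironaka`, LADDER-RESOLUTION rung L, slot W4.5(b)), working crux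
**EL♮ = `Theses.EquisingularLift.EquisingularLiftNat`** (stmt-ResolutionOfSingularities-20038), registered stub
`stub_elnat_three_isolated_nonabs`; target **T-CARRIER-Δ** of res-L1-w45b-lead-2 (TARGETS 2026-08-27, (2): «Δ-centres
inside a point-carrier as ideal sheaves, `C := St_τ(K) ⊔ E`»). OURS; NOT a statement of any manuscript; AI-written,
weaker than expert review. Filed `--supports stmt-ResolutionOfSingularities-20038 --as helper`.

RING-LEVEL CORE (everything for an arbitrary commutative ring `R`). Let `x = (x₁, …, x_r)` be a sequence in `R`,
`I = (x)`, `B = R[I/xᵢ] ⊆ R[1/xᵢ]` the affine blowup algebra (image model `blowupAlgebra`,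
`AffineBlowupAlgebra.lean`), `t = xᵢ/1 ∈ B` the equation of the exceptional divisor, `e_j = x_j/xᵢ` the chart
generators, and `Φ ∈ R[T₁, …, T_r]` a FORM of degree `d` — the cone `V(Φ(x)) ⊂ Spec R` through the centre `V(I)`.

* `algebraMap_eval_eq_pow_mul_coneTransform` — **`Φ(x) = tᵈ · Φ(e)` in `B`** (`Φ(e) = aeval e Φ`, the controlled
  transform of the cone);
* `coneTransform_eq_eval₂_dehomogenize` — `Φ(e) = Φᵢ(e)` with `Φᵢ = Φ(Tᵢ := 1)` the dehomogenisation
  (`Resolution.dehomogenize`), since `eᵢ = 1`;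
* `mk_coneTransform_eq` — modulo `t`, under `blowupAlgebraQuotEquiv : (R/I)[T_j : j ≠ i] ≅ B/(t)` (Stacks 0BIQ, `x`
  quasi-regular), **the trace of the cone's transform on the exceptional divisor is the DEHOMOGENISED REDUCED FORM
  `Φ̄ᵢ ∈ (R/I)[T_j : j ≠ i]`** (`Φ̄ = Φ mod I`);
* `mem_span_algebraMap_of_coneTransform_mul_mem`, `mem_span_coneTransform_of_algebraMap_mul_mem` — if `R/I` is a
  domain and `Φ̄ᵢ ≠ 0` (equivalently `Φ̄ ≠ 0`, dehomogenisation being injective on forms), then `Φ(e)` is a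
  nonzerodivisor modulo `t` and `t` is a nonzerodivisor modulo `Φ(e)`;
* `iSup_colon_span_pow_mul_eq` (generic) and **`iSup_colon_span_eval_eq_span_coneTransform`** — hence the
  SATURATION `⋃ₙ ((Φ(x)) : tⁿ)` — the ideal of the STRICT transform of the cone on the chart — **is `(Φ(e))`**, in `B`
  and (`…_localization`) in every localisation of `B` (the local rings of the blow-up at points of the chart);
* `quotient_span_coneTransform_sup_span_equiv` — **`B/(Φ(e), t) ≅ (R/I)[T_j : j ≠ i]/(Φ̄ᵢ)`**: the scheme
  `St(V(Φ(x))) ∩ E` is, on the chart, the relative hypersurface `V(Φ̄ᵢ)` of the affine space `E ∩ D₊(xᵢ) ≅ 𝔸^{r-1}_{R/I}`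
  over the centre — for `r = 3`, `R/I = O` a DVR: the Δ-curve `O[T₁, T₂]/(f)` of the toolkit D1
  (`…Theorems.EquisingularLiftEquisingularLiftNatDeltaCentre`, `deltaFlat` / `deltaRegularGeneric`).

The scheme-level reading (stalks of `strictTransformIdeal τ s.ker K ⊔ s.ker.comap τ` at the points of the blow-up of a
section over its closed point) is the sequel file `…NatCarrierDeltaStalks`.

References: The Stacks Project, Tags 052P, 0BIQ, 080C; U. Görtz, T. Wedhorn, *Algebraic Geometry I* (2020), (13.19).
-/

set_option linter.dupNamespace false -- mandated namespace `Summit.<Summit>.<Problem>` of this single-conjunct summit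

noncomputable section

namespace Summit.ResolutionOfSingularities.ResolutionOfSingularities.Cruxes.EquisingularLiftNat.Sections

open MvPolynomial IsLocalization Literature.AlgebraicGeometry.Resolution

universe u

/-! ## Generic saturation lemma: `⋃ₙ ((tᵈ c) : tⁿ) = (c)` -/

section Generic

variable {S : Type*} [CommRing S]

/-- **The saturation of `(tᵈ c)` by `t` is `(c)`** when `t` is a nonzerodivisor which stays a nonzerodivisor modulo
`c`: `⋃ₙ ((tᵈ · c) : tⁿ) = (c)` (induction on `d` from the tree's `iSup_colon_span_singleton_mul_pow_eq`,
`colon_span_singleton_mul_pow_succ`). [folklore] -/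
theorem iSup_colon_span_pow_mul_eq {t c : S} (ht : t ∈ nonZeroDivisors S)
    (h : ∀ y : S, t * y ∈ Ideal.span {c} → y ∈ Ideal.span {c}) (d : ℕ) :
    ⨆ n : ℕ, Submodule.colon (Ideal.span {t ^ d * c}) ((Ideal.span {t} ^ n : Ideal S) : Set S) =
      Ideal.span {c} := by
  induction d with
  | zero => rw [pow_zero, one_mul]; exact iSup_colon_span_singleton_pow_eq_of_regular h
  | succ d ih =>
    rw [← ih]
    apply le_antisymm
    · refine iSup_le fun n => ?_
      cases n with
      | zero =>
        refine le_iSup_of_le 0 ?_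
        intro y hy
        rw [mem_colon_span_singleton_pow_iff, pow_zero, mul_one] at hy ⊢
        obtain ⟨s, rfl⟩ := Ideal.mem_span_singleton'.mp hy
        exact Ideal.mem_span_singleton'.mpr ⟨s * t, by ring⟩
      | succ n =>
        rw [show t ^ (d + 1) * c = t * (t ^ d * c) by ring, colon_span_singleton_mul_pow_succ ht (t ^ d * c) n]
        exact le_iSup (fun n => Submodule.colon (Ideal.span {t ^ d * c}) ((Ideal.span {t} ^ n : Ideal S) : Set S)) n
    · refine iSup_le fun n => le_iSup_of_le (n + 1) ?_
      rw [show t ^ (d + 1) * c = t * (t ^ d * c) by ring, colon_span_singleton_mul_pow_succ ht (t ^ d * c) n]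

/-- Regularity modulo a principal ideal passes to localisations: if `t y ∈ (c) ⇒ y ∈ (c)` in `B`, then the same
holds for the images of `t`, `c` in any localisation `S` of `B`. [folklore] -/
theorem mem_span_algebraMap_of_mul_mem_localization {B : Type*} [CommRing B] (M : Submonoid B) (S : Type*)
    [CommRing S] [Algebra B S] [IsLocalization M S] {t c : B}
    (h : ∀ y : B, t * y ∈ Ideal.span {c} → y ∈ Ideal.span {c}) (y : S)
    (hy : algebraMap B S t * y ∈ Ideal.span {algebraMap B S c}) : y ∈ Ideal.span {algebraMap B S c} := by
  obtain ⟨⟨b, u⟩, hbu⟩ := IsLocalization.surj M y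
  -- `y * u = b`, so `t b / 1 = (t y) u ∈ (c) S`
  obtain ⟨z, hz⟩ := Ideal.mem_span_singleton'.mp hy
  obtain ⟨⟨b', u'⟩, hbu'⟩ := IsLocalization.surj M z
  -- `z * u' = b'`; then `t b u' = c b' u` up to a unit of `M`
  have key : algebraMap B S (t * b * u') = algebraMap B S (c * b' * u) := by
    have e1 : algebraMap B S b = y * algebraMap B S u := hbu.symm
    have e2 : algebraMap B S b' = z * algebraMap B S u' := hbu'.symm
    simp only [map_mul, e1, e2]
    linear_combination (-(algebraMap B S (u : B) * algebraMap B S (u' : B))) * hz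
  obtain ⟨v, hv⟩ := (IsLocalization.eq_iff_exists M S).mp key
  have hmem : t * ((v : B) * b * u') ∈ Ideal.span {c} :=
    Ideal.mem_span_singleton'.mpr ⟨(v : B) * b' * u, by
      have := hv; linear_combination (-1 : B) * this⟩
  obtain ⟨w, hw⟩ := Ideal.mem_span_singleton'.mp (h _ hmem)
  -- `y = b/u = (v b u')/(v u u') = w c/(v u u')`
  have hunit : IsUnit (algebraMap B S ((v : B) * u * u')) := by
    rw [map_mul, map_mul]
    exact ((IsLocalization.map_units S v).mul (IsLocalization.map_units S u)).mul (IsLocalization.map_units S u')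
  refine Ideal.mem_span_singleton'.mpr ⟨algebraMap B S w * hunit.unit⁻¹, ?_⟩
  have e3 : algebraMap B S w * algebraMap B S c = algebraMap B S ((v : B) * b * u') := by
    rw [← map_mul, hw]
  calc algebraMap B S w * ↑hunit.unit⁻¹ * algebraMap B S c
      = (algebraMap B S w * algebraMap B S c) * ↑hunit.unit⁻¹ := by ring
    _ = algebraMap B S ((v : B) * b * u') * ↑hunit.unit⁻¹ := by rw [e3]
    _ = y * algebraMap B S ((v : B) * u * u') * ↑hunit.unit⁻¹ := by
        congr 1
        simp only [map_mul]
        rw [← hbu]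
        ring
    _ = y := by rw [mul_assoc, IsUnit.mul_val_inv, mul_one]

end Generic

/-! ## The cone `V(Φ(x))` on the chart `R[I/xᵢ]` -/

section Chart

variable {R : Type u} [CommRing R] {r : ℕ} (x : Fin r → R) (i : Fin r)

/-- **`Φ(x) = tᵈ · Φ(e)` on the chart `R[I/xᵢ]`** for a form `Φ` of degree `d` in the generators `x` of the centre
(`t = xᵢ/1`, `e_j = x_j/xᵢ`; `x_j = t · e_j`). [folklore] -/
theorem algebraMap_eval_eq_pow_mul_coneTransform {d : ℕ} {Φ : MvPolynomial (Fin r) R} (hΦ : Φ.IsHomogeneous d) :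
    algebraMap R (blowupAlgebra (Ideal.span (Set.range x)) (x i)) (MvPolynomial.eval x Φ) =
      algebraMap R (blowupAlgebra (Ideal.span (Set.range x)) (x i)) (x i) ^ d *
        MvPolynomial.aeval (blowupAlgebra.frac x i) Φ := by
  classical
  -- adapted from `reesChartBase_eval_eq_pow_mul_eval₂` (Literature/AlgebraicGeometry/Resolution/BlowupChartQuasiRegular.lean)
  set B := blowupAlgebra (Ideal.span (Set.range x)) (x i)
  conv_lhs => rw [Φ.as_sum, map_sum, map_sum]
  conv_rhs => rw [Φ.as_sum, map_sum, Finset.mul_sum]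
  refine Finset.sum_congr rfl fun α hα => ?_
  have hdeg : α.degree = d := by
    by_contra h
    exact (MvPolynomial.mem_support_iff.mp hα) (hΦ.coeff_eq_zero h)
  rw [MvPolynomial.eval_monomial, MvPolynomial.aeval_monomial, map_mul, map_finsuppProd, Finsupp.prod,
    Finsupp.prod]
  have hx : ∀ j ∈ α.support, algebraMap R B (x j ^ α j) =
      algebraMap R B (x i) ^ α j * blowupAlgebra.frac x i j ^ α j := fun j _ => by
    rw [map_pow, ← mul_pow, blowupAlgebra.algebraMap_mul_gen]
  rw [Finset.prod_congr rfl hx, Finset.prod_mul_distrib, Finset.prod_pow_eq_pow_sum, ← Finsupp.degree_apply, hdeg]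
  ring

/-- `Φ(e) = Φᵢ(e)`: evaluating the form at the chart generators is evaluating its DEHOMOGENISATION `Φᵢ = Φ(Tᵢ := 1)`
at the generators `e_j`, `j ≠ i` (because `eᵢ = xᵢ/xᵢ = 1`). [folklore] -/
theorem coneTransform_eq_aeval_dehomogenize (Φ : MvPolynomial (Fin r) R) :
    MvPolynomial.aeval (blowupAlgebra.frac x i) Φ =
      MvPolynomial.aeval (fun j : {j : Fin r // j ≠ i} => blowupAlgebra.frac x i j.1) (dehomogenize i Φ) := by
  change _ = ((MvPolynomial.aeval fun j : {j : Fin r // j ≠ i} => blowupAlgebra.frac x i j.1).comp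
    (dehomogenize (R := R) i)) Φ
  congr 1
  refine MvPolynomial.algHom_ext fun j => ?_
  rw [AlgHom.comp_apply, MvPolynomial.aeval_X]
  change _ = MvPolynomial.aeval _ (MvPolynomial.aeval (killVar i) (MvPolynomial.X j))
  rw [MvPolynomial.aeval_X]
  by_cases hj : j = i
  · subst hj
    rw [killVar_self, map_one]
    exact blowupAlgebra.gen_self _ _ _
  · rw [killVar_of_ne i hj, MvPolynomial.aeval_X]

/-- **The trace on the exceptional divisor.** For `x` quasi-regular, under the chart identification
`(R/I)[T_j : j ≠ i] ≅ R[I/xᵢ]/(xᵢ)` (`blowupAlgebraQuotEquiv`, Stacks 0BIQ), the class of `Φ(e)` modulo `t = xᵢ` is the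
dehomogenised reduced form `Φ̄ᵢ = (Φ mod I)(Tᵢ := 1)`. [cite: StacksProject, Tag 0BIQ] -/
theorem mk_coneTransform_eq (hx : IsQuasiRegular x) (Φ : MvPolynomial (Fin r) R) :
    Ideal.Quotient.mk (Ideal.span {algebraMap R (blowupAlgebra (Ideal.span (Set.range x)) (x i)) (x i)})
        (MvPolynomial.aeval (blowupAlgebra.frac x i) Φ) =
      blowupAlgebraQuotEquiv x i hx
        (MvPolynomial.map (Ideal.Quotient.mk (Ideal.span (Set.range x))) (dehomogenize i Φ)) := by
  rw [blowupAlgebraQuotEquiv_map, coneTransform_eq_aeval_dehomogenize]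
  rfl

variable [IsDomain (R ⧸ Ideal.span (Set.range x))]

/-- If the centre `V(I)` is integral and the reduced form is non-zero on the chart (`Φ̄ᵢ ≠ 0`), then `Φ(e)` is a
nonzerodivisor modulo `t`: `Φ(e) · y ∈ (t) ⇒ y ∈ (t)` (the exceptional divisor `R[I/xᵢ]/(t) ≅ (R/I)[T]` of the chart is
a domain). [folklore] -/
theorem mem_span_algebraMap_of_coneTransform_mul_mem (hx : IsQuasiRegular x) {Φ : MvPolynomial (Fin r) R}
    (hΦ : MvPolynomial.map (Ideal.Quotient.mk (Ideal.span (Set.range x))) (dehomogenize i Φ) ≠ 0)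
    (y : blowupAlgebra (Ideal.span (Set.range x)) (x i))
    (hy : MvPolynomial.aeval (blowupAlgebra.frac x i) Φ * y ∈
      Ideal.span {algebraMap R (blowupAlgebra (Ideal.span (Set.range x)) (x i)) (x i)}) :
    y ∈ Ideal.span {algebraMap R (blowupAlgebra (Ideal.span (Set.range x)) (x i)) (x i)} := by
  haveI : IsDomain (blowupAlgebra (Ideal.span (Set.range x)) (x i) ⧸
      Ideal.span {algebraMap R (blowupAlgebra (Ideal.span (Set.range x)) (x i)) (x i)}) :=
    MulEquiv.isDomain (MvPolynomial {j : Fin r // j ≠ i} (R ⧸ Ideal.span (Set.range x)))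
      (blowupAlgebraQuotEquiv x i hx).symm.toMulEquiv
  refine mem_span_singleton_of_mul_mem_of_isDomain ?_ y hy
  rw [mk_coneTransform_eq x i hx]
  exact fun h => hΦ ((blowupAlgebraQuotEquiv x i hx).injective (h.trans (map_zero _).symm))

/-- … hence `t` is a nonzerodivisor modulo `Φ(e)`: `t · y ∈ (Φ(e)) ⇒ y ∈ (Φ(e))` (swap of the regular sequence
`t, Φ(e)`; `t` is a nonzerodivisor of `R[I/xᵢ]`, Stacks 07Z3 (1)). [folklore] -/
theorem mem_span_coneTransform_of_algebraMap_mul_mem (hx : IsQuasiRegular x) {Φ : MvPolynomial (Fin r) R}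
    (hΦ : MvPolynomial.map (Ideal.Quotient.mk (Ideal.span (Set.range x))) (dehomogenize i Φ) ≠ 0)
    (y : blowupAlgebra (Ideal.span (Set.range x)) (x i))
    (hy : algebraMap R (blowupAlgebra (Ideal.span (Set.range x)) (x i)) (x i) * y ∈
      Ideal.span {MvPolynomial.aeval (blowupAlgebra.frac x i) Φ}) :
    y ∈ Ideal.span {MvPolynomial.aeval (blowupAlgebra.frac x i) Φ} :=
  mem_span_singleton_of_mul_mem_of_swap (S := blowupAlgebra (Ideal.span (Set.range x)) (x i))
    (t := algebraMap R (blowupAlgebra (Ideal.span (Set.range x)) (x i)) (x i))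
    (c := MvPolynomial.aeval (blowupAlgebra.frac x i) Φ)
    (algebraMap_mem_nonZeroDivisors_blowupAlgebra (I := Ideal.span (Set.range x)) (a := x i))
    (mem_span_algebraMap_of_coneTransform_mul_mem x i hx hΦ) hy

/-- **The strict transform of the cone on the chart is `V(Φ(e))`**: the saturation `⋃ₙ ((Φ(x)) : tⁿ)` of the total
transform by the exceptional divisor is the principal ideal `(Φ(e))` of `R[I/xᵢ]` (`Φ` a form of degree `d`, `x`
quasi-regular, `V(I)` integral, `Φ̄ᵢ ≠ 0`). [cite: GortzWedhorn2020, (13.19) p. 414] -/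
theorem iSup_colon_span_eval_eq_span_coneTransform (hx : IsQuasiRegular x) {d : ℕ} {Φ : MvPolynomial (Fin r) R}
    (hΦd : Φ.IsHomogeneous d)
    (hΦ : MvPolynomial.map (Ideal.Quotient.mk (Ideal.span (Set.range x))) (dehomogenize i Φ) ≠ 0) :
    ⨆ n : ℕ, Submodule.colon
        (Ideal.span {algebraMap R (blowupAlgebra (Ideal.span (Set.range x)) (x i)) (MvPolynomial.eval x Φ)})
        ((Ideal.span {algebraMap R (blowupAlgebra (Ideal.span (Set.range x)) (x i)) (x i)} ^ n :
          Ideal (blowupAlgebra (Ideal.span (Set.range x)) (x i))) : Set _) =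
      Ideal.span {MvPolynomial.aeval (blowupAlgebra.frac x i) Φ} := by
  rw [algebraMap_eval_eq_pow_mul_coneTransform x i hΦd]
  exact iSup_colon_span_pow_mul_eq (S := blowupAlgebra (Ideal.span (Set.range x)) (x i))
    (t := algebraMap R (blowupAlgebra (Ideal.span (Set.range x)) (x i)) (x i))
    (c := MvPolynomial.aeval (blowupAlgebra.frac x i) Φ)
    (algebraMap_mem_nonZeroDivisors_blowupAlgebra (I := Ideal.span (Set.range x)) (a := x i))
    (mem_span_coneTransform_of_algebraMap_mul_mem x i hx hΦ) d

/-- **The same in every localisation `S` of the chart** (the local rings of the blow-up at the points of the chart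
`D₊(xᵢ)`): `⋃ₙ ((Φ(x)) : tⁿ) = (Φ(e))` in `S`. [cite: GortzWedhorn2020, (13.19) p. 414] -/
theorem iSup_colon_span_eval_eq_span_coneTransform_localization (hx : IsQuasiRegular x) {d : ℕ}
    {Φ : MvPolynomial (Fin r) R} (hΦd : Φ.IsHomogeneous d)
    (hΦ : MvPolynomial.map (Ideal.Quotient.mk (Ideal.span (Set.range x))) (dehomogenize i Φ) ≠ 0)
    (M : Submonoid (blowupAlgebra (Ideal.span (Set.range x)) (x i))) (S : Type*) [CommRing S]
    [Algebra (blowupAlgebra (Ideal.span (Set.range x)) (x i)) S]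
    [IsLocalization M S] :
    ⨆ n : ℕ, Submodule.colon
        (Ideal.span {algebraMap (blowupAlgebra (Ideal.span (Set.range x)) (x i)) S
          (algebraMap R (blowupAlgebra (Ideal.span (Set.range x)) (x i)) (MvPolynomial.eval x Φ))})
        ((Ideal.span {algebraMap (blowupAlgebra (Ideal.span (Set.range x)) (x i)) S
          (algebraMap R (blowupAlgebra (Ideal.span (Set.range x)) (x i)) (x i))} ^ n : Ideal S) : Set S) =
      Ideal.span {algebraMap (blowupAlgebra (Ideal.span (Set.range x)) (x i)) S
        (MvPolynomial.aeval (blowupAlgebra.frac x i) Φ)} := by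
  rw [algebraMap_eval_eq_pow_mul_coneTransform x i hΦd, map_mul, map_pow]
  exact iSup_colon_span_pow_mul_eq (S := S)
    (t := algebraMap _ S (algebraMap R (blowupAlgebra (Ideal.span (Set.range x)) (x i)) (x i)))
    (c := algebraMap _ S (MvPolynomial.aeval (blowupAlgebra.frac x i) Φ))
    (IsLocalization.nonZeroDivisors_le_comap M S
      (algebraMap_mem_nonZeroDivisors_blowupAlgebra (I := Ideal.span (Set.range x)) (a := x i)))
    (mem_span_algebraMap_of_mul_mem_localization M S (mem_span_coneTransform_of_algebraMap_mul_mem x i hx hΦ)) d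

omit [IsDomain (R ⧸ Ideal.span (Set.range x))] in
/-- **`R[I/xᵢ]/(Φ(e), t) ≅ (R/I)[T_j : j ≠ i]/(Φ̄ᵢ)`**, with `r/1 ↦ r̄` and `x_j/xᵢ ↦ T_j`: on the chart, the
scheme-theoretic intersection of the strict transform of the cone with the exceptional divisor is the relative
hypersurface `V(Φ̄ᵢ)` of the affine space `𝔸^{r-1}_{V(I)}` over the centre (`x` quasi-regular; no integrality needed).
[cite: StacksProject, Tag 0BIQ] -/
theorem exists_quotient_coneTransform_sup_equiv (hx : IsQuasiRegular x) (Φ : MvPolynomial (Fin r) R) :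
    ∃ ε : (blowupAlgebra (Ideal.span (Set.range x)) (x i) ⧸
        (Ideal.span {MvPolynomial.aeval (blowupAlgebra.frac x i) Φ} ⊔
          Ideal.span {algebraMap R (blowupAlgebra (Ideal.span (Set.range x)) (x i)) (x i)})) ≃+*
        (MvPolynomial {j : Fin r // j ≠ i} (R ⧸ Ideal.span (Set.range x)) ⧸
          Ideal.span {MvPolynomial.map (Ideal.Quotient.mk (Ideal.span (Set.range x))) (dehomogenize i Φ)}),
      (∀ a : R, ε (Ideal.Quotient.mk _ (algebraMap R _ a)) =
        Ideal.Quotient.mk _ (MvPolynomial.C (Ideal.Quotient.mk _ a))) ∧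
      (∀ j : {j : Fin r // j ≠ i}, ε (Ideal.Quotient.mk _ (blowupAlgebra.frac x i j.1)) =
        Ideal.Quotient.mk _ (MvPolynomial.X j)) := by
  set B := blowupAlgebra (Ideal.span (Set.range x)) (x i) with hB
  set t : B := algebraMap R B (x i) with ht
  set G' : B := MvPolynomial.aeval (blowupAlgebra.frac x i) Φ with hG'
  set Φbar := MvPolynomial.map (Ideal.Quotient.mk (Ideal.span (Set.range x))) (dehomogenize i Φ) with hΦbar
  let ε₀ := blowupAlgebraQuotEquiv x i hx
  -- the surjection `ψ : B → B/(t) ≅ (R/I)[T] → (R/I)[T]/(Φ̄ᵢ)` and its kernel `(G') ⊔ (t)`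
  let ψ : B →+* MvPolynomial {j : Fin r // j ≠ i} (R ⧸ Ideal.span (Set.range x)) ⧸ Ideal.span {Φbar} :=
    ((Ideal.Quotient.mk (Ideal.span {Φbar})).comp (ε₀.symm : _ →+* _)).comp (Ideal.Quotient.mk (Ideal.span {t}))
  have hψ : Function.Surjective ψ :=
    (Ideal.Quotient.mk_surjective.comp ε₀.symm.surjective).comp Ideal.Quotient.mk_surjective
  have hε₀G' : ε₀.symm (Ideal.Quotient.mk (Ideal.span {t}) G') = Φbar := by
    rw [RingEquiv.symm_apply_eq, hG', mk_coneTransform_eq x i hx]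
  have hker : RingHom.ker ψ = Ideal.span {G'} ⊔ Ideal.span {t} := by
    change RingHom.ker (RingHom.comp _ _) = _
    rw [← RingHom.comap_ker, ← RingHom.comap_ker, Ideal.mk_ker]
    have h1 : (Ideal.span {Φbar}).comap (ε₀.symm : _ →+* _) =
        (Ideal.span {G'}).map (Ideal.Quotient.mk (Ideal.span {t})) := by
      rw [Ideal.map_span, Set.image_singleton, ← hε₀G']
      exact Ideal.comap_symm _ |>.trans (by rw [Ideal.map_span, Set.image_singleton, RingEquiv.apply_symm_apply])
    rw [h1, Ideal.comap_map_of_surjective _ Ideal.Quotient.mk_surjective, ← RingHom.ker_eq_comap_bot, Ideal.mk_ker]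
  refine ⟨(Ideal.quotEquivOfEq hker.symm).trans (RingHom.quotientKerEquivOfSurjective hψ), fun a => ?_, fun j => ?_⟩
  · change RingHom.quotientKerEquivOfSurjective hψ (Ideal.quotEquivOfEq hker.symm (Ideal.Quotient.mk _ _)) = _
    rw [Ideal.quotEquivOfEq_mk, RingHom.quotientKerEquivOfSurjective_apply_mk]
    change Ideal.Quotient.mk _ (ε₀.symm (Ideal.Quotient.mk _ (algebraMap R B a))) = _
    congr 1
    rw [RingEquiv.symm_apply_eq, blowupAlgebraQuotEquiv_C]
  · change RingHom.quotientKerEquivOfSurjective hψ (Ideal.quotEquivOfEq hker.symm (Ideal.Quotient.mk _ _)) = _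
    rw [Ideal.quotEquivOfEq_mk, RingHom.quotientKerEquivOfSurjective_apply_mk]
    change Ideal.Quotient.mk _ (ε₀.symm (Ideal.Quotient.mk _ (blowupAlgebra.frac x i j.1))) = _
    congr 1
    rw [RingEquiv.symm_apply_eq, blowupAlgebraQuotEquiv_X]

end Chart

end Summit.ResolutionOfSingularities.ResolutionOfSingularities.Cruxes.EquisingularLiftNat.Sections

end
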